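import Mathlib
import Summits.MatrixMultiplication.MatrixMultiplication.Theses.FourierTwoFamiliesModP
import Summits.MatrixMultiplication.MatrixMultiplication.Cruxes.PrimeDensityDecay.SketchK1
import Literature.Computability.AlgebraicComplexity.SimultaneousDoubleProduct

/-!
# Line `kronecker-coupling` — skeleton for the crux `PrimeDensityDecay`
(stmt-MatrixMultiplication-14311, route `FourierTwoFamiliesModP`, rank 4), round 1, gen 1

Crux (fixed, the route's decl): `∀ ε > 0 ∃ s₀ ∀ p prime ∀ n s (A B : Fin n → Finset (ZMod p)),
s₀ ≤ s → |A i| = |B i| = s → (W) → (X) → n·s ≤ ε·p`.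

Notation (informal): `X = ⊔ A i`, `Y = ⊔ B i`, `ρ = n s / p`, matched pairs `M = ⊔ A i ×ˢ B i`
(`|M| = n s²`), sharing multiplicity `D(d) = #{i : d ∈ A i − B i}` (`Σ_d D(d) = n s²`, `D ≤ n` by (W)),
`lowMass K s A B` = number of matched pairs whose difference has `D ≤ K s` (from `SketchK1`),
`gridMass G A B` = number of matched pairs whose difference lies in `G`,
`coincidences A B = Σ_d D(d)²`, `m* = Σ D² / Σ D`.

## What the idea card said and what the triage panel did to it

Card `Ideas/kronecker-coupling.md`: read clause (X) as a COUPLING of the uniform measures on `X` and `Y`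
whose difference law sits on the (near-)zero set of `1_X ∗ 1_{−Y}`; positivity + Bohr-continuity of the
coupling functional against the Kronecker factor forces `m* ≥ C s` for every `C` ("MultiplicityForcing"),
and the crux is EQUIVALENT to its coherent half `CoherentDecay`.
Triage r1 (×3 pass, ×3 MERGE into `low-multiplicity-removal-dichotomy`): `MultiplicityForcing` is a
three-line Markov corollary of that card's first lemma `Sketch.LowMultiplicityRegime` (Green's arithmetic
removal with the private differences truncated at multiplicity `K s`; kernel-checked in
`TRIAGE-r1-3-W2.lean` and triage-2's `MarkovLemma.lean`), so the Bohr/regularity engine buys nothing at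
this rung; `CoherentDecay (∃ C ∀ ε)` is the dominated residual; "if the coupling functional is kept at
all, its job is INSIDE the heavy core"; and (r1-3 on the sibling card `common-grid-factorization-
rigidity`, r1-1 panel summary) the open part after round 1 is ONE residual whose extreme point —
equidifferent / common-grid families, `D ≡ n` on one `s²`-set `G` — is where every known design lives,
"a stability version ('most pairs share most of G') is needed before [common-grid rigidity] meets the
heavy core".

## This skeleton = the card's thesis pushed one rung up, cut at that gap (3 registered stubs)

The card's thesis is "density FORCES coherence; the crux is its coherent half". Round 1 settled the
first rung of the coherence scale (`m* ≫ s`, by removal). This line registers the NEXT rung as its heart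
and hands the endgame a hypothesis strong enough for rigidity tools:

* `stub_tailRemoval` — `TailRemoval` (provable now, size M; the removal engine replacing the Bohr engine,
  per triage ×3): for all `K`, `η > 0`, `ε > 0` there is `s₀` such that a balanced SDPP family with
  `s ≥ s₀` whose matched pairs put mass `≥ η·n s²` on differences of multiplicity `≤ K s` has `n s ≤ ε p`.
  This is `Sketch.LowMultiplicityRegime` with the hard-wired `1/2` replaced by `η` (same proof:
  `Green2005_1_5_holds`, `k = 3`, sets `(X, −Y, −L_K)`; `ε' := ε η /(K+2)`); PROVED in this file:
  `TailRemoval → Sketch.LowMultiplicityRegime` and `Sketch.LowMultiplicityRegime → MultiplicityForcing`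
  (port of W2.lean), so landing stub 1 lands the sibling line's first stub and the card's "theorem".
* `stub_gridConcentration` — THE HEART (open, XL): `TailRemoval → DenseGridConcentration`:
  `∀ ε ∃ L ∀ η ∃ s₀`: a balanced SDPP family with `s ≥ s₀` and density `n s ≥ ε p` has a set `G` of at
  most `L·s²` differences carrying `(1 − η)` of its matched mass (`gridMass G A B ≥ (1−η) n s²`).
  Since `D ≤ n`, any such `G` has `|G| ≥ (1−η) s²`, so the conclusion says the matched-difference law is
  supported, up to `η`, on a set within the factor `L` of its minimum possible size — equivalently
  (Cauchy–Schwarz / Markov) coherence LINEAR in `n` (`m* ≥ (1−η)² n / L`), the top of the scale on which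
  removal delivers `m* ≥ K s`. Exactly common-grid families (translates, radix digit designs, unshrunk
  CRT cubes) have `L = 1, η = 0`; the notion is robust under the balancing shrink `IsSDPP.mono`
  (sub-blocks keep their differences inside the original grid), which the exact common-grid class is not.
* `stub_gridDecay` — the ENDGAME (open, L–XL): `GridDecay`: `∀ ε ∀ L ∃ η > 0 ∃ s₀`: a balanced SDPP
  family with `s ≥ s₀` that is `(L, η)`-grid-concentrated has `n s ≤ ε p` — the crux restricted to
  near-common-grid families, i.e. the sibling card's isolation / factorisation-counting target in the
  STABLE form the panel asked for. Non-vacuity: if `L s² ≥ p` the hypothesis is free (`G = univ`) but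
  then `n ≤ p/s² ≤ L` and the conclusion is trivial for `s ≥ L/ε`; the content is `p > L s²`, `n ≫ s`.
* `PrimeDensityDecay_of : PrimeDensityDecay` — the composition, a real proof concluding the crux BY NAME
  (given `ε`: `L` from the heart, `(η, s₃)` from the endgame at `(ε, L)`, `s₂` from the heart at `η`;
  for `s ≥ max s₂ s₃` a family is either sparse already or dense, then grid-concentrated, then sparse).

Each stub is implied by the crux (1: drop the mass hypothesis; 2: by the crux at `ε/2` no dense family
exists for large `s`; 3: drop the grid hypothesis) and their conjunction gives the crux: an equivalent
decomposition into individually weaker statements, none restating the crux (no costume), two of them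
open and named (no single unnamed hard step).

Proved in this file (sorry-free, not registered): `lowMultiplicityRegime_of_tailRemoval`,
`multiplicityForcing_of_lowMultiplicityRegime` (port of TRIAGE-r1-3-W2.lean, verbatim statements),
`multiplicityForcing_of_tailRemoval`, `mult_le` (`D ≤ n` from (W)), `coincidences_le`
(`Σ D² ≤ n · n s²`, i.e. `m* ≤ n`: linear coherence is the END of the scale), `gridMass_le`,
`gridMass_univ`, and the COHERENCE SCALE: `gridMass_eq_sum_Dmult` (`gridMass G = Σ_{d∈G} D(d)`),
`sum_sq_Dmult_le_coincidences`, `gridMass_sq_le` (Cauchy–Schwarz `(gridMass G)² ≤ |G| · Σ D²`), and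
`denseLinearCoherence_of_denseGridConcentration` — the heart's conclusion implies the typed milestone
`DenseLinearCoherence` (dense ⇒ `Σ D² ≥ c(ε) · n · n s²`, i.e. `m* ≥ c n`), which sits strictly above
the card's `MultiplicityForcing` (`m* ≥ C s`) on that scale.  Rungs, bottom to top:
`m* ≥ ρ s` (Cauchy–Schwarz, free) < `m* ≥ K s ∀ K` (removal: stub 1 + Markov, provable now)
< `m* ≥ c(ε) n` (milestone) < `(1−η)`-mass on `L(ε) s²` differences (heart) ≤ `m* ≤ n` (ceiling).

Disproof used: `payload.disproof_path` (run/gate/evidence/…/20260815T225235Z-Disproof.lean, cdisprove v4)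
and `Cruxes/PrimeDensityDecay/Disproof.lean` are NOT readable/present on this hub (checked 2026-08-16;
same for all three triagers); used through the v1–v4 evidence notes on the item. Honoured:
`_false_without_W` — (W) is used by stub 1 (`p ≥ s²`, "each `d ∈ L_K` lies in `≤ K s` solutions",
`D ≤ n`: `mult_le` below needs exactly (W)) and by stub 3 (directness of the near-common grid);
`_false_without_X` — faithfulness `1_X ∗ 1_{−Y} = D` on the private differences (stub 1's solution
count) IS clause (X); `primeDensityDecay_false_without_W'` (interleaved APs at density ≥ 1/4 when (W) is
weakened to `s² ≤ p`) — every stub carries full (W); `translate_bound_tight` / `translate_family_bound`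
(`n s² ≤ p` on translates) — translates are `(1,0)`-grid-concentrated and are the first test family of
stub 3 (consistent: density `1/s`); `sdpp_lift` / `densityDecay_all_moduli_of_crux` — nothing here uses
primality beyond the crux's own quantifier. No `Theorems/…/PrimeDensityDecay/Negative/*` lemma has
landed (directory absent 2026-08-16), so no stub instance is refuted and nothing is imported beyond the
route file, `SketchK1` (shared `lowMass` / `LowMultiplicityRegime`) and the tree SDPP API.
-/

namespace Summit.MatrixMultiplication.MatrixMultiplication.Cruxes.PrimeDensityDecay.KroneckerCoupling

open scoped BigOperators
open Finset
open Summit.MatrixMultiplication.MatrixMultiplication.Theses.FourierTwoFamiliesModP (PrimeDensityDecay)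
open Summit.MatrixMultiplication.MatrixMultiplication.Cruxes.PrimeDensityDecay.Sketch
  (lowMass LowMultiplicityRegime HeavyCoreDecay)
open Literature.Computability.AlgebraicComplexity (IsSDPP)

section Defs

variable {p n : ℕ}

/-- Matched mass on a set of differences: the number of matched pairs `(a, b) ∈ A i ×ˢ B i` (over all
`i`) with `a - b ∈ G`.  `gridMass univ A B = n s²` for a balanced family. -/
def gridMass (G : Finset (ZMod p)) (A B : Fin n → Finset (ZMod p)) : ℕ :=
  ∑ i : Fin n, ((A i ×ˢ B i).filter (fun q : ZMod p × ZMod p => q.1 - q.2 ∈ G)).card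

/-- Sharing multiplicity of the difference of a pair `q`: `D(q.1 - q.2) = #{(j, r) : r ∈ A j ×ˢ B j,
r.1 - r.2 = q.1 - q.2}` (under (W) each block contributes at most once, `mult_le`).  This is exactly the
inner sum of `Sketch.lowMass`. -/
def mult (A B : Fin n → Finset (ZMod p)) (q : ZMod p × ZMod p) : ℕ :=
  ∑ j : Fin n, ((A j ×ˢ B j).filter (fun r : ZMod p × ZMod p => r.1 - r.2 = q.1 - q.2)).card

/-- `coincidences A B = Σ_d D(d)² = Σ_{i,j} T_{ij}`: ordered pairs of matched pairs with equal difference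
(verbatim from the idea card / TRIAGE-r1-3-W2.lean). -/
def coincidences (A B : Fin n → Finset (ZMod p)) : ℕ :=
  ∑ i, ∑ j, (((A i ×ˢ B i) ×ˢ (A j ×ˢ B j)).filter fun q => q.1.1 - q.1.2 = q.2.1 - q.2.2).card

end Defs

/-! ## The three statements of the line -/

/-- **Tail removal** (stub 1; provable now from `Green2005_1_5_holds`, `k = 3`): for every multiplicity
cut `K`, mass fraction `η > 0` and `ε > 0` there is `s₀ = s₀(K, η, ε)` such that every balanced SDPP
family in `ZMod p` with `s ≥ s₀` whose matched pairs put mass `≥ η · n s²` on private differences of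
sharing multiplicity `≤ K s` has density `n s ≤ ε p`.  (`Sketch.LowMultiplicityRegime` is the case
`η = 1/2`.)  Proof route: the equation `x + y + z = 0` on `(X, −Y, −L_K)`, `L_K = {d : D(d) ≤ K s}`, has
exactly `lowMass K s A B` solutions (faithfulness, from (X)); `lowMass ≤ n s² ≤ p s ≤ p²/s ≤ δ p²` for
`s ≥ 1/δ` (since `n s ≤ p` and `s² ≤ p`, tree `IsSDPP.sum_card_left_le`, `IsSDPP.card_mul_card_le`);
removing `≤ ε' p` elements from each set kills every solution, and a removed `x ∈ X` or `y ∈ Y` lies in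
`≤ s` solutions, a removed `d ∈ L_K` in `≤ K s`; so `η n s² ≤ lowMass ≤ ε' p s (K + 2)`; take
`ε' = ε η / (K + 2)`. -/
def TailRemoval : Prop :=
  ∀ (K : ℕ) (η ε : ℝ), 0 < η → 0 < ε → ∃ s₀ : ℕ, ∀ p : ℕ, p.Prime →
    ∀ (n s : ℕ) (A B : Fin n → Finset (ZMod p)), s₀ ≤ s →
    (∀ i : Fin n, (A i).card = s ∧ (B i).card = s) →
    (∀ i : Fin n, ∀ a ∈ A i, ∀ a' ∈ A i, ∀ b ∈ B i, ∀ b' ∈ B i,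
      (a - a') + (b - b') = 0 → a = a' ∧ b = b') →
    (∀ i j k : Fin n, ∀ a ∈ A i, ∀ a' ∈ A j, ∀ b ∈ B j, ∀ b' ∈ B k,
      (a - a') + (b - b') = 0 → i = k) →
    η * ((n : ℝ) * (s : ℝ) ^ 2) ≤ (lowMass K s A B : ℝ) →
    (n : ℝ) * (s : ℝ) ≤ ε * (p : ℝ)

/-- **Dense ⇒ grid-concentrated** (conclusion of stub 2, THE HEART; open): for every `ε > 0` there is a
grid scale `L = L(ε)` such that for every tolerance `η > 0` and all `s ≥ s₀(ε, η)`, a balanced SDPP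
family in `ZMod p` of density `n s ≥ ε p` has a set `G` of at most `L · s²` differences with
`gridMass G A B ≥ (1 − η) · n s²` (all but an `η`-fraction of the matched pairs have their difference
in `G`).  Implied by the crux (at `ε/2` no such family exists); the bet is that it is a WAYPOINT: the
coherence scale `m* ≥ K s` (removal) → `m* ≥ c n` (a constant fraction of the mass on `O(s²)`
differences) → `(1 − η)` of the mass on `O(s²)` differences. -/
def DenseGridConcentration : Prop :=
  ∀ ε : ℝ, 0 < ε → ∃ L : ℕ, ∀ η : ℝ, 0 < η → ∃ s₀ : ℕ, ∀ p : ℕ, p.Prime →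
    ∀ (n s : ℕ) (A B : Fin n → Finset (ZMod p)), s₀ ≤ s →
    (∀ i : Fin n, (A i).card = s ∧ (B i).card = s) →
    (∀ i : Fin n, ∀ a ∈ A i, ∀ a' ∈ A i, ∀ b ∈ B i, ∀ b' ∈ B i,
      (a - a') + (b - b') = 0 → a = a' ∧ b = b') →
    (∀ i j k : Fin n, ∀ a ∈ A i, ∀ a' ∈ A j, ∀ b ∈ B j, ∀ b' ∈ B k,
      (a - a') + (b - b') = 0 → i = k) →
    ε * (p : ℝ) ≤ (n : ℝ) * (s : ℝ) →
    ∃ G : Finset (ZMod p), G.card ≤ L * s ^ 2 ∧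
      (1 - η) * ((n : ℝ) * (s : ℝ) ^ 2) ≤ (gridMass G A B : ℝ)

/-- **Grid decay** (stub 3, the ENDGAME; open): for every `ε > 0` and grid scale `L` there are a tolerance
`η = η(ε, L) > 0` and `s₀` such that every balanced SDPP family in `ZMod p` with `s ≥ s₀` whose matched
mass is `(1 − η)`-carried by some set of at most `L · s²` differences has density `n s ≤ ε p`.
The crux restricted to near-common-grid families.  Calibration (folder `calc/grid_profile_out.txt`):
translates and radix digit designs are `(1, 0)`-grid-concentrated (all `A i − B i` equal one `s²`-set);
the balanced CRT cube of the route's `WallBreachModP` calibration (`ℤ/2520`, `n = 6`, `s = 24`) has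
`|supp D| = 2.32 s²` and `L(η) = 1.94, 1.49, 0.96` at `η = 0.1, 0.25, 0.5`, although balancing
destroys the EXACT common grid there (`m*/n = 0.46`, `D ∈ [1, 4]`) — the notion is shrink-robust;
along the WallBreach CRT family `|supp D|/s² = ∏_{u ≤ l} 2u/(2u−1) ≈ 1.77 √l` grows, but its density
decays like `2^l m^{-l}`, far from the dense regime.  When `L s² ≥ p` the hypothesis is free
(`G = univ`, `gridMass_univ`) but then `n ≤ p / s² ≤ L` and the conclusion is trivial for
`s ≥ L / ε`, so the content is the regime `p > L s²`, `n ≫ s`. -/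
def GridDecay : Prop :=
  ∀ ε : ℝ, 0 < ε → ∀ L : ℕ, ∃ η : ℝ, 0 < η ∧ ∃ s₀ : ℕ, ∀ p : ℕ, p.Prime →
    ∀ (n s : ℕ) (A B : Fin n → Finset (ZMod p)), s₀ ≤ s →
    (∀ i : Fin n, (A i).card = s ∧ (B i).card = s) →
    (∀ i : Fin n, ∀ a ∈ A i, ∀ a' ∈ A i, ∀ b ∈ B i, ∀ b' ∈ B i,
      (a - a') + (b - b') = 0 → a = a' ∧ b = b') →
    (∀ i j k : Fin n, ∀ a ∈ A i, ∀ a' ∈ A j, ∀ b ∈ B j, ∀ b' ∈ B k,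
      (a - a') + (b - b') = 0 → i = k) →
    (∃ G : Finset (ZMod p), G.card ≤ L * s ^ 2 ∧
      (1 - η) * ((n : ℝ) * (s : ℝ) ^ 2) ≤ (gridMass G A B : ℝ)) →
    (n : ℝ) * (s : ℝ) ≤ ε * (p : ℝ)

/-- The idea card's "THEOREM" (verbatim, over `IsSDPP`): dense balanced SDPP families have
`Σ D² ≥ C · s · n s²` for every `C`, i.e. `m*/s → ∞`.  PROVED below from `TailRemoval`
(via `Sketch.LowMultiplicityRegime`, port of TRIAGE-r1-3-W2.lean) — it is no longer a stub. -/
def MultiplicityForcing : Prop :=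
  ∀ ε : ℝ, 0 < ε → ∀ C : ℝ, ∃ s₀ : ℕ, ∀ p : ℕ, p.Prime →
    ∀ (n s : ℕ) (A B : Fin n → Finset (ZMod p)), s₀ ≤ s →
      (∀ i, (A i).card = s ∧ (B i).card = s) → IsSDPP A B → ε * p ≤ n * s →
      C * s * (n * s ^ 2) ≤ (coincidences A B : ℝ)

/-! ## Proved links (sorry-free) -/

/-- `TailRemoval` at `η = 1/2` is the sibling line's first stub `Sketch.LowMultiplicityRegime`
(real proof). -/
theorem lowMultiplicityRegime_of_tailRemoval (h : TailRemoval) : LowMultiplicityRegime := by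
  intro K ε hε
  obtain ⟨s₀, hs₀⟩ := h K (1 / 2) ε (by norm_num) hε
  refine ⟨s₀, ?_⟩
  intro p hp n s A B hs hcard hW hX hlow
  refine hs₀ p hp n s A B hs hcard hW hX ?_
  have hlow' : ((n : ℝ) * (s : ℝ) ^ 2) ≤ 2 * (lowMass K s A B : ℝ) := by
    exact_mod_cast hlow
  linarith

section MarkovPort

/-! Port of `TRIAGE-r1-3-W2.lean` (triager k = 3), stated over `Sketch.lowMass` /
`Sketch.LowMultiplicityRegime` (which W2 copied verbatim). -/

variable {p n : ℕ}

theorem card_filter_product {α β : Type*} (S : Finset α) (T : Finset β) (R : α → β → Prop)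
    [∀ a b, Decidable (R a b)] :
    ((S ×ˢ T).filter (fun q => R q.1 q.2)).card = ∑ a ∈ S, (T.filter (fun b => R a b)).card := by
  simp only [Finset.card_filter]
  rw [Finset.sum_product]

theorem coincidences_eq (A B : Fin n → Finset (ZMod p)) :
    coincidences A B = ∑ i, ∑ q ∈ A i ×ˢ B i, mult A B q := by
  unfold coincidences mult
  refine Finset.sum_congr rfl fun i _ => ?_
  rw [Finset.sum_comm]
  refine Finset.sum_congr rfl fun j _ => ?_
  rw [card_filter_product (A i ×ˢ B i) (A j ×ˢ B j) (fun q r => q.1 - q.2 = r.1 - r.2)]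
  refine Finset.sum_congr rfl fun q _ => ?_
  congr 1
  ext r
  simp only [Finset.mem_filter, eq_comm]

theorem lowMass_eq (K s : ℕ) (A B : Fin n → Finset (ZMod p)) :
    lowMass K s A B = ∑ i, ∑ q ∈ A i ×ˢ B i, (if mult A B q ≤ K * s then 1 else 0) := by
  unfold Sketch.lowMass mult
  refine Finset.sum_congr rfl fun i _ => ?_
  rw [Finset.card_filter]

theorem gridMass_eq (G : Finset (ZMod p)) (A B : Fin n → Finset (ZMod p)) :
    gridMass G A B = ∑ i, ∑ q ∈ A i ×ˢ B i, (if q.1 - q.2 ∈ G then 1 else 0) := by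
  unfold gridMass
  refine Finset.sum_congr rfl fun i _ => ?_
  rw [Finset.card_filter]

theorem sum_one_eq (s : ℕ) (A B : Fin n → Finset (ZMod p))
    (hcard : ∀ i : Fin n, (A i).card = s ∧ (B i).card = s) :
    n * s ^ 2 = ∑ i : Fin n, ∑ _q ∈ A i ×ˢ B i, 1 := by
  simp only [Finset.sum_const, smul_eq_mul, mul_one, Finset.card_product]
  have : ∀ i : Fin n, (A i).card * (B i).card = s ^ 2 := fun i => by
    rw [(hcard i).1, (hcard i).2, sq]
  simp only [this, Finset.sum_const, Finset.card_univ, Fintype.card_fin, smul_eq_mul]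

theorem key_ineq (K s : ℕ) (A B : Fin n → Finset (ZMod p))
    (hcard : ∀ i : Fin n, (A i).card = s ∧ (B i).card = s) :
    (K * s + 1) * (n * s ^ 2) ≤ coincidences A B + (K * s + 1) * lowMass K s A B := by
  rw [sum_one_eq s A B hcard, coincidences_eq, lowMass_eq, Finset.mul_sum, Finset.mul_sum,
    ← Finset.sum_add_distrib]
  refine Finset.sum_le_sum fun i _ => ?_
  rw [Finset.mul_sum, Finset.mul_sum, ← Finset.sum_add_distrib]
  refine Finset.sum_le_sum fun q _ => ?_
  split_ifs with h
  · omega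
  · push Not at h
    omega

/-- MERGE CERTIFICATE (triage r1-3, W2.lean), re-homed: the card's theorem follows from the sibling
line's first stub by Markov on the multiplicity profile — no Bohr factor, no regularity stopping time. -/
theorem multiplicityForcing_of_lowMultiplicityRegime (hL : LowMultiplicityRegime) :
    MultiplicityForcing := by
  intro ε hε C
  set K : ℕ := ⌈2 * C⌉₊ with hK
  obtain ⟨s₀, hs₀⟩ := hL K (ε / 2) (by positivity)
  refine ⟨s₀, ?_⟩
  intro p hp n s A B hs hcard hS hdense
  have hp0 : (0 : ℝ) < p := by exact_mod_cast hp.pos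
  by_cases hlow : n * s ^ 2 ≤ 2 * lowMass K s A B
  · have h1 := hs₀ p hp n s A B hs hcard hS.1 hS.2 hlow
    exfalso
    nlinarith [mul_pos hε hp0]
  · push Not at hlow
    have h3 := key_ineq K s A B hcard
    have h3' : ((K : ℝ) * s + 1) * ((n : ℝ) * (s : ℝ) ^ 2) ≤
        (coincidences A B : ℝ) + ((K : ℝ) * s + 1) * (lowMass K s A B : ℝ) := by
      exact_mod_cast h3
    have hlow' : 2 * (lowMass K s A B : ℝ) < (n : ℝ) * (s : ℝ) ^ 2 := by
      exact_mod_cast hlow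
    have hKC : 2 * C ≤ (K : ℝ) := Nat.le_ceil _
    have hs0 : (0 : ℝ) ≤ s := Nat.cast_nonneg _
    have hN0 : (0 : ℝ) ≤ (n : ℝ) * (s : ℝ) ^ 2 := by positivity
    have hKs0 : (0 : ℝ) ≤ (K : ℝ) * s := by positivity
    set N2 : ℝ := (n : ℝ) * (s : ℝ) ^ 2 with hN2
    set L : ℝ := (lowMass K s A B : ℝ) with hLdef
    set Co : ℝ := (coincidences A B : ℝ) with hCo
    have step1 : ((K : ℝ) * s + 1) * (N2 / 2) ≤ Co := by nlinarith
    have step2 : C * s * N2 ≤ ((K : ℝ) * s) * (N2 / 2) := by nlinarith [mul_nonneg hs0 hN0]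
    nlinarith

/-- The card's theorem from stub 1 of this line. -/
theorem multiplicityForcing_of_tailRemoval (h : TailRemoval) : MultiplicityForcing :=
  multiplicityForcing_of_lowMultiplicityRegime (lowMultiplicityRegime_of_tailRemoval h)

end MarkovPort

section Calibration

/-! Elementary bounds placing the heart's conclusion at the TOP of the coherence scale. -/

variable {p n : ℕ}

/-- (W) ⇒ each block represents a difference at most once, so `D ≤ n`. -/
theorem mult_le (A B : Fin n → Finset (ZMod p))
    (hW : ∀ i : Fin n, ∀ a ∈ A i, ∀ a' ∈ A i, ∀ b ∈ B i, ∀ b' ∈ B i,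
      (a - a') + (b - b') = 0 → a = a' ∧ b = b')
    (q : ZMod p × ZMod p) : mult A B q ≤ n := by
  unfold mult
  calc ∑ j : Fin n, ((A j ×ˢ B j).filter (fun r : ZMod p × ZMod p => r.1 - r.2 = q.1 - q.2)).card
      ≤ ∑ _j : Fin n, 1 := by
        refine Finset.sum_le_sum fun j _ => ?_
        refine Finset.card_le_one.mpr ?_
        intro r hr r' hr'
        rw [Finset.mem_filter, Finset.mem_product] at hr hr'
        obtain ⟨⟨ha, hb⟩, hd⟩ := hr
        obtain ⟨⟨ha', hb'⟩, hd'⟩ := hr'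
        have hsum : (r.1 - r'.1) + (r'.2 - r.2) = 0 := by
          have : r.1 - r.2 = r'.1 - r'.2 := by rw [hd, hd']
          linear_combination this
        obtain ⟨h1, h2⟩ := hW j r.1 ha r'.1 ha' r'.2 hb' r.2 hb hsum
        exact Prod.ext h1 h2.symm
    _ = n := by simp

/-- `Σ D² ≤ n · (n s²)`, i.e. `m* ≤ n`: coherence linear in `n` (what the heart asserts for dense
families, via grid concentration) is the end of the scale on which removal gives `m* ≥ K s`. -/
theorem coincidences_le (s : ℕ) (A B : Fin n → Finset (ZMod p))
    (hcard : ∀ i : Fin n, (A i).card = s ∧ (B i).card = s)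
    (hW : ∀ i : Fin n, ∀ a ∈ A i, ∀ a' ∈ A i, ∀ b ∈ B i, ∀ b' ∈ B i,
      (a - a') + (b - b') = 0 → a = a' ∧ b = b') :
    coincidences A B ≤ n * (n * s ^ 2) := by
  rw [coincidences_eq, sum_one_eq s A B hcard, Finset.mul_sum]
  refine Finset.sum_le_sum fun i _ => ?_
  rw [Finset.mul_sum]
  refine Finset.sum_le_sum fun q _ => ?_
  simpa using mult_le A B hW q

/-- The matched mass on any set of differences is at most the total matched mass `n s²`. -/
theorem gridMass_le (s : ℕ) (G : Finset (ZMod p)) (A B : Fin n → Finset (ZMod p))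
    (hcard : ∀ i : Fin n, (A i).card = s ∧ (B i).card = s) :
    gridMass G A B ≤ n * s ^ 2 := by
  rw [gridMass_eq, sum_one_eq s A B hcard]
  refine Finset.sum_le_sum fun i _ => ?_
  refine Finset.sum_le_sum fun q _ => ?_
  split_ifs <;> omega

/-- With the whole group as grid, every matched pair counts: `gridMass univ A B = n s²`
(so `GridDecay` at `L s² ≥ p` is the crux in the trivial regime `n ≤ L`). -/
theorem gridMass_univ [NeZero p] (s : ℕ) (A B : Fin n → Finset (ZMod p))
    (hcard : ∀ i : Fin n, (A i).card = s ∧ (B i).card = s) :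
    gridMass (Finset.univ : Finset (ZMod p)) A B = n * s ^ 2 := by
  rw [gridMass_eq, sum_one_eq s A B hcard]
  refine Finset.sum_congr rfl fun i _ => ?_
  refine Finset.sum_congr rfl fun q _ => ?_
  simp

end Calibration

section CoherenceScale

/-! The coherence scale, kernel-checked: `gridMass G ^ 2 ≤ |G| · coincidences` (Cauchy–Schwarz on the
multiplicity profile), hence the heart's conclusion implies LINEAR coherence
`coincidences ≥ c(ε) · n · (n s²)` for dense families (`DenseLinearCoherence`, the milestone the lead
may land `--supports` before the full heart), which sits above the card's `MultiplicityForcing`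
(`≥ C s · n s²`, removal + Markov) and below the absolute ceiling `coincidences_le` (`≤ n · n s²`). -/

variable {p n : ℕ}

/-- Sharing multiplicity of a difference `d`: `D(d) = Σ_j #{r ∈ A j ×ˢ B j : r.1 - r.2 = d}`
(`mult A B q = Dmult A B (q.1 - q.2)` by `rfl`). -/
def Dmult (A B : Fin n → Finset (ZMod p)) (d : ZMod p) : ℕ :=
  ∑ j : Fin n, ((A j ×ˢ B j).filter (fun r : ZMod p × ZMod p => r.1 - r.2 = d)).card

theorem mult_eq_Dmult (A B : Fin n → Finset (ZMod p)) (q : ZMod p × ZMod p) :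
    mult A B q = Dmult A B (q.1 - q.2) := rfl

theorem card_filter_mem_eq_sum (S : Finset (ZMod p × ZMod p)) (G : Finset (ZMod p)) :
    (S.filter (fun r : ZMod p × ZMod p => r.1 - r.2 ∈ G)).card =
      ∑ d ∈ G, (S.filter (fun r : ZMod p × ZMod p => r.1 - r.2 = d)).card := by
  have H : ∀ r ∈ S.filter (fun r : ZMod p × ZMod p => r.1 - r.2 ∈ G),
      (fun r : ZMod p × ZMod p => r.1 - r.2) r ∈ G := fun r hr => (Finset.mem_filter.mp hr).2
  rw [Finset.card_eq_sum_card_fiberwise H]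
  refine Finset.sum_congr rfl fun d hd => ?_
  congr 1
  ext r
  simp only [Finset.mem_filter]
  constructor
  · rintro ⟨⟨hr, _⟩, h⟩
    exact ⟨hr, h⟩
  · rintro ⟨hr, h⟩
    exact ⟨⟨hr, h ▸ hd⟩, h⟩

/-- `gridMass G = Σ_{d ∈ G} D(d)` (real proof). -/
theorem gridMass_eq_sum_Dmult (G : Finset (ZMod p)) (A B : Fin n → Finset (ZMod p)) :
    gridMass G A B = ∑ d ∈ G, Dmult A B d := by
  unfold gridMass Dmult
  rw [Finset.sum_comm]
  exact Finset.sum_congr rfl fun i _ => card_filter_mem_eq_sum (A i ×ˢ B i) G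

/-- `Σ_{d ∈ G} D(d)² ≤ Σ_d D(d)² = coincidences` (real proof; no `Fintype (ZMod p)` needed). -/
theorem sum_sq_Dmult_le_coincidences (G : Finset (ZMod p)) (A B : Fin n → Finset (ZMod p)) :
    ∑ d ∈ G, Dmult A B d ^ 2 ≤ coincidences A B := by
  have step : ∀ i : Fin n,
      ∑ d ∈ G, ((A i ×ˢ B i).filter (fun r : ZMod p × ZMod p => r.1 - r.2 = d)).card * Dmult A B d
        ≤ ∑ q ∈ A i ×ˢ B i, Dmult A B (q.1 - q.2) := by
    intro i
    calc ∑ d ∈ G, ((A i ×ˢ B i).filter (fun r : ZMod p × ZMod p => r.1 - r.2 = d)).card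
              * Dmult A B d
        = ∑ d ∈ G, ∑ _r ∈ (A i ×ˢ B i).filter (fun r : ZMod p × ZMod p => r.1 - r.2 = d),
            Dmult A B d := by
          refine Finset.sum_congr rfl fun d _ => ?_
          rw [Finset.sum_const, smul_eq_mul]
      _ = ∑ q ∈ (A i ×ˢ B i).filter (fun r : ZMod p × ZMod p => r.1 - r.2 ∈ G),
            Dmult A B (q.1 - q.2) :=
          Finset.sum_fiberwise_eq_sum_filter' _ _ _ _
      _ ≤ ∑ q ∈ A i ×ˢ B i, Dmult A B (q.1 - q.2) :=
          Finset.sum_le_sum_of_subset (Finset.filter_subset _ _)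
  calc ∑ d ∈ G, Dmult A B d ^ 2
      = ∑ d ∈ G, ∑ i : Fin n,
          ((A i ×ˢ B i).filter (fun r : ZMod p × ZMod p => r.1 - r.2 = d)).card * Dmult A B d := by
        refine Finset.sum_congr rfl fun d _ => ?_
        rw [sq, ← Finset.sum_mul]
        rfl
    _ = ∑ i : Fin n, ∑ d ∈ G,
          ((A i ×ˢ B i).filter (fun r : ZMod p × ZMod p => r.1 - r.2 = d)).card * Dmult A B d :=
        Finset.sum_comm
    _ ≤ ∑ i : Fin n, ∑ q ∈ A i ×ˢ B i, Dmult A B (q.1 - q.2) :=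
        Finset.sum_le_sum fun i _ => step i
    _ = coincidences A B := by
        simp only [coincidences_eq, mult_eq_Dmult]

/-- **Cauchy–Schwarz on the multiplicity profile**: `(gridMass G)² ≤ |G| · Σ D²` (real proof). -/
theorem gridMass_sq_le (G : Finset (ZMod p)) (A B : Fin n → Finset (ZMod p)) :
    gridMass G A B ^ 2 ≤ G.card * coincidences A B := by
  calc gridMass G A B ^ 2 = (∑ d ∈ G, Dmult A B d) ^ 2 := by rw [gridMass_eq_sum_Dmult]
    _ ≤ G.card * ∑ d ∈ G, Dmult A B d ^ 2 := by
        have h := sq_sum_le_card_mul_sum_sq (s := G) (f := fun d => Dmult A B d)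
        exact_mod_cast h
    _ ≤ G.card * coincidences A B := Nat.mul_le_mul_left _ (sum_sq_Dmult_le_coincidences G A B)

/-- MILESTONE (not registered): dense balanced SDPP families are LINEARLY coherent —
`Σ D² ≥ c(ε) · n · (n s²)`, i.e. `m* ≥ c(ε) · n` (a `c/2`-fraction of the matched mass on
`≤ 2 s²/c` differences).  Implied by the heart (`denseLinearCoherence_of_denseGridConcentration`,
real proof) and itself far beyond the removal rung `m* ≥ K s`; a natural first target for the lead,
landable with `--supports stmt-MatrixMultiplication-14311`. -/
def DenseLinearCoherence : Prop :=
  ∀ ε : ℝ, 0 < ε → ∃ c : ℝ, 0 < c ∧ ∃ s₀ : ℕ, ∀ p : ℕ, p.Prime →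
    ∀ (n s : ℕ) (A B : Fin n → Finset (ZMod p)), s₀ ≤ s →
    (∀ i : Fin n, (A i).card = s ∧ (B i).card = s) →
    (∀ i : Fin n, ∀ a ∈ A i, ∀ a' ∈ A i, ∀ b ∈ B i, ∀ b' ∈ B i,
      (a - a') + (b - b') = 0 → a = a' ∧ b = b') →
    (∀ i j k : Fin n, ∀ a ∈ A i, ∀ a' ∈ A j, ∀ b ∈ B j, ∀ b' ∈ B k,
      (a - a') + (b - b') = 0 → i = k) →
    ε * (p : ℝ) ≤ (n : ℝ) * (s : ℝ) →
    c * ((n : ℝ) * ((n : ℝ) * (s : ℝ) ^ 2)) ≤ (coincidences A B : ℝ)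

/-- The heart's conclusion sits at the top of the coherence scale: grid concentration at tolerance
`1/2` already gives linear coherence with `c = 1 / (4 (L + 1))` (real proof, Cauchy–Schwarz). -/
theorem denseLinearCoherence_of_denseGridConcentration (h : DenseGridConcentration) :
    DenseLinearCoherence := by
  intro ε hε
  obtain ⟨L, hL⟩ := h ε hε
  obtain ⟨s₀, hs₀⟩ := hL (1 / 2) (by norm_num)
  refine ⟨1 / (4 * ((L : ℝ) + 1)), by positivity, s₀, ?_⟩
  intro p hp n s A B hs hcard hW hX hdense
  obtain ⟨G, hGcard, hGmass⟩ := hs₀ p hp n s A B hs hcard hW hX hdense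
  have hcs : ((gridMass G A B : ℕ) : ℝ) ^ 2 ≤ (G.card : ℝ) * (coincidences A B : ℝ) := by
    exact_mod_cast gridMass_sq_le G A B
  have hGcard' : (G.card : ℝ) ≤ (L : ℝ) * (s : ℝ) ^ 2 := by exact_mod_cast hGcard
  set N2 : ℝ := (n : ℝ) * (s : ℝ) ^ 2 with hN2def
  set gm : ℝ := ((gridMass G A B : ℕ) : ℝ) with hgmdef
  set Co : ℝ := ((coincidences A B : ℕ) : ℝ) with hCodef
  have hN2 : 0 ≤ N2 := by positivity
  have hgm0 : 0 ≤ gm := by positivity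
  have hco : 0 ≤ Co := by positivity
  have hL0 : (0 : ℝ) ≤ L := Nat.cast_nonneg _
  have hgm : N2 ≤ 2 * gm := by linarith
  have hsq : N2 ^ 2 ≤ (2 * gm) ^ 2 := by
    apply sq_le_sq' <;> linarith
  have h2 : (2 * gm) ^ 2 ≤ 4 * ((G.card : ℝ) * Co) := by
    have : (2 * gm) ^ 2 = 4 * gm ^ 2 := by ring
    rw [this]
    linarith [hcs]
  have h3 : (G.card : ℝ) * Co ≤ ((L : ℝ) * (s : ℝ) ^ 2) * Co :=
    mul_le_mul_of_nonneg_right hGcard' hco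
  have h1 : N2 ^ 2 ≤ 4 * ((L : ℝ) * (s : ℝ) ^ 2) * Co := by linarith
  -- goal: 1 / (4 (L+1)) * (n * N2) ≤ Co
  have key : (n : ℝ) * N2 ≤ 4 * ((L : ℝ) + 1) * Co := by
    by_cases hs0 : s = 0
    · subst hs0
      have : N2 = 0 := by rw [hN2def]; simp
      rw [this, mul_zero]
      positivity
    · have hspos : (0 : ℝ) < (s : ℝ) := by exact_mod_cast Nat.pos_of_ne_zero hs0
      have hs2 : (0 : ℝ) < (s : ℝ) ^ 2 := by positivity
      have h4 : ((n : ℝ) * N2) * (s : ℝ) ^ 2 ≤ (4 * ((L : ℝ) + 1) * Co) * (s : ℝ) ^ 2 := by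
        have e : ((n : ℝ) * N2) * (s : ℝ) ^ 2 = N2 ^ 2 := by rw [hN2def]; ring
        rw [e]
        nlinarith [h1, hco, hs2.le]
      exact le_of_mul_le_mul_right h4 hs2
  have e2 : 1 / (4 * ((L : ℝ) + 1)) * ((n : ℝ) * N2) = ((n : ℝ) * N2) / (4 * ((L : ℝ) + 1)) := by
    ring
  rw [e2, div_le_iff₀ (by positivity)]
  linarith [key]

end CoherenceScale


/-! ## Registered stubs -/

/-- **stub 1 — tail removal (provable now; size M).** `η`-uniform multiplicity-truncated arithmetic
removal: see `TailRemoval`.  Inputs: `Literature.Combinatorics.Additive.Green2005_1_5_holds` (PROVED in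
tree; `k = 3`, `G := ZMod p`, sets `![X, -Y, -L_K]` as `Fin 3 → Finset (ZMod p)`), faithfulness
(`x - y ∈ L_K` with `x ∈ A i`, `y ∈ B k` forces `i = k`, from (X)), `D ≤ n`/`≤ K s` bookkeeping
(`mult_le` style), `n s ≤ p` and `s² ≤ p` (tree `IsSDPP.sum_card_left_le`, `IsSDPP.card_mul_card_le`,
after `(isSDPP_iff _ _).mpr ⟨hW, hX⟩`).  Landing it also lands `Sketch.LowMultiplicityRegime` and the
card's `MultiplicityForcing` (proved links above). -/
theorem stub_tailRemoval : TailRemoval := by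
  sorry

/-- **stub 2 — THE HEART: density forces grid concentration (open; size XL).** Given tail removal at
every `(K, η)`, a dense balanced SDPP family with `s` large concentrates all but `η` of its matched
mass on `L(ε) · s²` differences: see `DenseGridConcentration`.  Known first rung (free from the
hypothesis `h`): for every `K`, `η`: `lowMass K s A B < η n s²` once `s ≥ s₀(K, η, ε)`, i.e. the
matched-difference law lives on `{D > K s}`, a set of size `< n s / K`; the heart must shrink the
support from `o(n s)` to `O(s²)`.  Intermediate milestone worth landing `--supports`: LINEAR COHERENCE
`coincidences A B ≥ c(ε) · n · (n s²)` for dense families (a `c/2`-fraction of the mass on `≤ 2 s²/c`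
differences, by Markov), before the full `(1 − η)` statement.  Candidate mechanisms (none is a theorem;
see the line card): (a) the card's coupling functional run on the BLOCK-COINCIDENCE Gram matrix
`T_{ij} = |(A i − B i) ∩ (A j − B j)|` (PSD, trace `n s²`, entry sum `Σ D²`) instead of the Bohr
factor of `ZMod p` — "intermediate coherence" means intermediate rank, i.e. several sub-families with
nearly disjoint difference supports, and cross-family clause (X) says `X^{(u)} − Y^{(w)}` avoids the
whole support of family `v` for `(u, w) ≠ (v, v)`; (b) popular-difference transversals: for `d` with
`D(d) > K s`, `X ∩ (Y + d)` is a partial transversal of `> K s` blocks (faithfulness), and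
`TranslateRigidity` (a translate of a block meets `X` and `Y` in at most ONE common block) prices how
transversals through different `d` can share blocks. -/
theorem stub_gridConcentration (h : TailRemoval) : DenseGridConcentration := by
  sorry

/-- **stub 3 — THE ENDGAME: grid-concentrated families are sparse (open; size L–XL).** See `GridDecay`.
The exact extreme (`L = 1`, `η = 0`, all `A i − B i = G`) is the sibling card
`common-grid-factorization-rigidity`'s target: there (X) ⟺ isolation `(G + B k) ∩ X = A k` for every
`k` (proved in that ideator's Sketch), translation-equivalent blocks pack (`Sketch.TranslatePacking`:
`m · s² ≤ p` per shape, so a dense family needs `≥ ρ s → ∞` translation-inequivalent direct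
factorisations `G = A k ⊖ B k` of ONE set), and the per-block Fourier handle of triage r1-2 applies
(`1_G ∗ 1_Y ≡ s` on `X` forces `max_{ξ≠0} |Ĝ(ξ)| ≥ s(ρ s − 1)`, hence `|Â_k(ξ)|, |B̂_k(ξ)| ≥ ρ s − 1`
at ONE common frequency for EVERY block).  The registered form is the STABLE one the panel asked for
(most pairs of most blocks on a common `O(s²)`-set; by Markov the prover may pass to a sub-family in
which every block has `≥ (1 − √η) s²` of its pairs on `G`, at density cost `(1 − √η)`; exact
all-pairs-on-`G` sub-rectangles of linear size are NOT available in general — Kővári–Sós–Turán — so the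
endgame must tolerate `√η` defects per block).  First arena (triage r1-3): `G` a digit cube
`S ⊕ M·S ⊕ ⋯`, where the count `4(M−2) < M²` is exactly why radix designs decay. -/
theorem stub_gridDecay : GridDecay := by
  sorry

/-! ## Composition (kernel-checked; concludes the crux BY NAME) -/

/-- The line closes the crux modulo its three stubs: tail removal feeds the heart; given `ε`, take the
heart's grid scale `L`, the endgame's tolerance `η(ε, L)` and threshold, then the heart's threshold at
`η`; a family with `s` beyond both thresholds is either already `ε`-sparse or dense, hence
`(L, η)`-grid-concentrated (heart), hence `ε`-sparse (endgame). -/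
theorem PrimeDensityDecay_of : PrimeDensityDecay := by
  intro ε hε
  obtain ⟨L, hL⟩ := stub_gridConcentration stub_tailRemoval ε hε
  obtain ⟨η, hη, s₃, h₃⟩ := stub_gridDecay ε hε L
  obtain ⟨s₂, h₂⟩ := hL η hη
  refine ⟨max s₂ s₃, ?_⟩
  intro p hp n s A B hs hcard hW hX
  by_cases hdense : ε * (p : ℝ) ≤ (n : ℝ) * (s : ℝ)
  · obtain ⟨G, hG⟩ := h₂ p hp n s A B (le_trans (le_max_left _ _) hs) hcard hW hX hdense
    exact h₃ p hp n s A B (le_trans (le_max_right _ _) hs) hcard hW hX ⟨G, hG⟩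
  · exact le_of_lt (lt_of_not_ge hdense)

end Summit.MatrixMultiplication.MatrixMultiplication.Cruxes.PrimeDensityDecay.KroneckerCoupling
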